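import Mathlib
import Literature.Probability.LatticeModels.GKSInequalities
import HarnessLib

/-!
# Exact inverse-M certificates for finite zero-field Ising ferromagnets (uniform coupling)

A kernel-checkable certificate format, with its soundness theorem, for the statement

  `(Σ⁻¹)_{xy} ≤ 0` for all `x ≠ y` and ALL couplings `K ≥ 0`,

where `Σ_{pq} = ⟨σ_pσ_q⟩` is the spin second-moment matrix of the zero-field Ising model on a
finite graph `G = (Fin n, E)` with the SAME coupling `K` on every edge (the system
`gksExpect univ (fun _ => K) (edgeSet n E)` of Friedli–Velenik 2017, §3.8.1).  This is the finite-graph,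
uniform-coupling instance of the inverse-M-matrix question of Lauritzen–Uhler–Zwiernik (2021, §5)
for Ising models [cite: LauritzenUhlerZwiernik2021, §5].

## The certificate

Put `v := e^{2K} − 1 ≥ 0`.  Since `e^{Ks} = e^{−K}(1 + ((1+s)/2)·v)` for `s = ±1`, the unnormalised
matrix `S_{pq} = ∑_ω σ_pσ_q e^{K ∑_{ab ∈ E} σ_aσ_b}` equals `e^{−|E|K} · M_{pq}(v)` with the INTEGER
polynomial matrix (Edwards–Sokal / high-temperature form)

  `M_{pq}(v) = ∑_{ω ∈ {±1}^n} σ_pσ_q (1+v)^{sat(ω)}`,  `sat(ω) = #{ab ∈ E : σ_a = σ_b}`.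

A certificate is: the matrix `M` itself (as data, re-checked against the enumeration), an integer
polynomial matrix `B(v)` (given as a table of distinct entries plus an index matrix) and an integer
polynomial `d(v)` such that (1) `M(v)B(v) = d(v)·1` identically, (2) every coefficient of `d` is
`≥ 0` and `d(0) > 0`, (3) every coefficient of every off-diagonal entry of `B` is `≤ 0`.  Then for
`v ≥ 0`: `d(v) > 0`, `M(v)⁻¹ = d(v)⁻¹ B(v)`, and `Σ⁻¹ = (Z e^{|E|K}) M(v)⁻¹` has off-diagonal entries
`≤ 0` (`inv_entry_nonpos_of_check`, in the companion file `IsingInverseMCertificateSound.lean`).  In practice `B = adj M / g`, `d = det M / g`; condition (2)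
always holds for `det M` (Cauchy–Binet), condition (3) is the univariate shadow of the
coefficientwise conjecture "POS-v".  All functions are structurally recursive on lists / naturals so
that `decide` (kernel) or `native_decide` can run `check`.

Polynomials are dense coefficient lists `List ℤ`, low degree first; spin configurations are coded
by `k < 2^n`, site `p` carrying spin `+1` iff bit `p` of `k` is `1`.

References: Friedli–Velenik 2017 §3.7.3 (high-temperature representation), §3.8.1 (the systems
`ν_{Λ;K}`); Lauritzen–Uhler–Zwiernik 2021 §5 (the inverse-M question). [cite: FriedliVelenik2017, §3.8.1]
-/

namespace Literature.Probability.LatticeModels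

open Finset Matrix

namespace IsingPolynomial

/-! ### Dense integer polynomials -/

/-- Evaluation of a coefficient list (low degree first) at `v` in a commutative ring. [folklore] -/
def leval {R : Type*} [CommRing R] : List ℤ → R → R
  | [], _ => 0
  | c :: cs, v => (c : R) + v * leval cs v

/-- Sum of coefficient lists. [folklore] -/
def ladd : List ℤ → List ℤ → List ℤ
  | [], q => q
  | c :: cs, [] => c :: cs
  | c :: cs, e :: es => (c + e) :: ladd cs es

/-- Scalar multiple of a coefficient list. [folklore] -/
def lsmul (a : ℤ) : List ℤ → List ℤ
  | [] => []
  | c :: cs => (a * c) :: lsmul a cs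

/-- Product of coefficient lists. [folklore] -/
def lmul : List ℤ → List ℤ → List ℤ
  | [], _ => []
  | c :: cs, q => ladd (lsmul c q) (0 :: lmul cs q)

/-- All coefficients vanish. [folklore] -/
def lIsZero : List ℤ → Bool
  | [] => true
  | c :: cs => (c == 0) && lIsZero cs

/-- Equality of coefficient lists as polynomials (trailing zeros ignored). [folklore] -/
def lEq : List ℤ → List ℤ → Bool
  | [], q => lIsZero q
  | c :: cs, [] => lIsZero (c :: cs)
  | c :: cs, e :: es => (c == e) && lEq cs es

/-- All coefficients `≥ 0`. [folklore] -/
def lNonneg : List ℤ → Bool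
  | [] => true
  | c :: cs => decide (0 ≤ c) && lNonneg cs

/-- All coefficients `≤ 0`. [folklore] -/
def lNonpos : List ℤ → Bool
  | [] => true
  | c :: cs => decide (c ≤ 0) && lNonpos cs

/-- Positive constant coefficient. [folklore] -/
def lPosHead : List ℤ → Bool
  | [] => false
  | c :: _ => decide (0 < c)

/-- Coefficient list of `(1+v)^s`. [folklore] -/
def onePlusPow : ℕ → List ℤ
  | 0 => [1]
  | s + 1 => ladd (onePlusPow s) (0 :: onePlusPow s)

/-- Sum of a list of coefficient lists. [folklore] -/
def lsum : List (List ℤ) → List ℤ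
  | [] => []
  | p :: ps => ladd p (lsum ps)

section eval

variable {R : Type*} [CommRing R] (v : R)

/-- `leval [] v = 0`. [folklore] -/
@[simp] theorem leval_nil : leval ([] : List ℤ) v = 0 := rfl

/-- `leval (c :: cs) v = c + v · leval cs v`. [folklore] -/
@[simp] theorem leval_cons (c : ℤ) (cs : List ℤ) : leval (c :: cs) v = (c : R) + v * leval cs v := rfl

/-- `leval` is additive. [folklore] -/
theorem leval_ladd (p q : List ℤ) : leval (ladd p q) v = leval p v + leval q v := by
  induction p generalizing q with
  | nil => simp [ladd]
  | cons c cs ih =>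
    cases q with
    | nil => simp [ladd]
    | cons e es => simp only [ladd, leval_cons, ih, Int.cast_add]; ring

/-- `leval` commutes with scalars. [folklore] -/
theorem leval_lsmul (a : ℤ) (p : List ℤ) : leval (lsmul a p) v = (a : R) * leval p v := by
  induction p with
  | nil => simp [lsmul]
  | cons c cs ih => simp only [lsmul, leval_cons, ih, Int.cast_mul]; ring

/-- `leval` is multiplicative. [folklore] -/
theorem leval_lmul (p q : List ℤ) : leval (lmul p q) v = leval p v * leval q v := by
  induction p with
  | nil => simp [lmul]
  | cons c cs ih => simp only [lmul, leval_ladd, leval_lsmul, leval_cons, ih, Int.cast_zero]; ring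

/-- A list of zeros evaluates to `0`. [folklore] -/
theorem leval_eq_zero_of_lIsZero {p : List ℤ} (h : lIsZero p = true) : leval p v = 0 := by
  induction p with
  | nil => rfl
  | cons c cs ih =>
    simp only [lIsZero, Bool.and_eq_true, beq_iff_eq] at h
    simp [h.1, ih h.2]

/-- `lEq`-equal lists evaluate equally. [folklore] -/
theorem leval_eq_of_lEq {p q : List ℤ} (h : lEq p q = true) : leval p v = leval q v := by
  induction p generalizing q with
  | nil => exact (leval_eq_zero_of_lIsZero v h).symm
  | cons c cs ih =>
    cases q with
    | nil => exact leval_eq_zero_of_lIsZero v h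
    | cons e es =>
      simp only [lEq, Bool.and_eq_true, beq_iff_eq] at h
      simp [h.1, ih h.2]

/-- `onePlusPow s` evaluates to `(1+v)^s`. [folklore] -/
theorem leval_onePlusPow (s : ℕ) : leval (onePlusPow s) v = (1 + v) ^ s := by
  induction s with
  | zero => simp [onePlusPow]
  | succ s ih => simp only [onePlusPow, leval_ladd, leval_cons, ih, Int.cast_zero]; ring

/-- `lsum` evaluates to the sum of the evaluations. [folklore] -/
theorem leval_lsum (ps : List (List ℤ)) : leval (lsum ps) v = (ps.map fun p => leval p v).sum := by
  induction ps with
  | nil => rfl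
  | cons p ps ih => simp [lsum, leval_ladd, ih]

end eval

/-- Nonnegative coefficients give a nonnegative value on `v ≥ 0`. [folklore] -/
theorem leval_nonneg {p : List ℤ} (h : lNonneg p = true) {v : ℝ} (hv : 0 ≤ v) : 0 ≤ leval p v := by
  induction p with
  | nil => simp
  | cons c cs ih =>
    simp only [lNonneg, Bool.and_eq_true, decide_eq_true_eq] at h
    simp only [leval_cons]
    exact add_nonneg (by exact_mod_cast h.1) (mul_nonneg hv (ih h.2))

/-- Nonpositive coefficients give a nonpositive value on `v ≥ 0`. [folklore] -/
theorem leval_nonpos {p : List ℤ} (h : lNonpos p = true) {v : ℝ} (hv : 0 ≤ v) : leval p v ≤ 0 := by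
  induction p with
  | nil => simp
  | cons c cs ih =>
    simp only [lNonpos, Bool.and_eq_true, decide_eq_true_eq] at h
    simp only [leval_cons]
    have h1 : (c : ℝ) ≤ 0 := by exact_mod_cast h.1
    nlinarith [ih h.2]

/-- Nonnegative coefficients and a positive constant give a positive value on `v ≥ 0`. [folklore] -/
theorem leval_pos {p : List ℤ} (h : lNonneg p = true) (h0 : lPosHead p = true) {v : ℝ} (hv : 0 ≤ v) :
    0 < leval p v := by
  cases p with
  | nil => simp [lPosHead] at h0
  | cons c cs =>
    simp only [lNonneg, Bool.and_eq_true, decide_eq_true_eq] at h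
    simp only [lPosHead, decide_eq_true_eq] at h0
    simp only [leval_cons]
    exact add_pos_of_pos_of_nonneg (by exact_mod_cast h0) (mul_nonneg hv (leval_nonneg h.2 hv))

/-! ### The Edwards–Sokal polynomial matrix of a graph, by enumeration of `{±1}^n` -/

/-- Bit `p` of `k`. [folklore] -/
def bit (k p : ℕ) : ℕ := k / 2 ^ p % 2

/-- Spin at site `p` of the configuration coded by `k` (`+1` iff bit `p` is set). [folklore] -/
def spinOf (k p : ℕ) : ℤ := if bit k p = 1 then 1 else -1

/-- Number of satisfied edges (`σ_a = σ_b`) of configuration `k`. [folklore] -/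
def satCount (k : ℕ) : List (ℕ × ℕ) → ℕ
  | [] => 0
  | e :: es => if bit k e.1 = bit k e.2 then satCount k es + 1 else satCount k es

/-- The contribution `σ_pσ_q (1+v)^{sat}` of configuration `k` to `M_{pq}`. [folklore] -/
def term (E : List (ℕ × ℕ)) (p q k : ℕ) : List ℤ :=
  lsmul (spinOf k p * spinOf k q) (onePlusPow (satCount k E))

/-- `∑_{j < 2^d} f (2^d k + j)` for coefficient lists, by binary splitting (recursion depth `d`, so
that the kernel evaluates it without deep recursion). [folklore] -/
def cfgSum (f : ℕ → List ℤ) : ℕ → ℕ → List ℤ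
  | 0, k => f k
  | d + 1, k => ladd (cfgSum f d (2 * k)) (cfgSum f d (2 * k + 1))

/-- The Edwards–Sokal entry `M_{pq}(v) = ∑_ω σ_pσ_q (1+v)^{sat(ω)}` of the graph `(Fin n, E)`. [folklore] -/
def entry (n : ℕ) (E : List (ℕ × ℕ)) (p q : ℕ) : List ℤ := cfgSum (term E p q) n 0

/-! ### The certificate checker -/

/-- Entry `(p,q)` of a table of coefficient lists. [folklore] -/
def getPoly (T : List (List (List ℤ))) (p q : ℕ) : List ℤ := (T.getD p []).getD q []

/-- Entry `(p,q)` of the certificate matrix `B`, stored as distinct classes plus an index matrix. [folklore] -/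
def getB (Bcls : List (List ℤ)) (Bidx : List (List ℕ)) (p q : ℕ) : List ℤ :=
  Bcls.getD ((Bidx.getD p []).getD q 0) []

/-- Entry `(p,q)` of the product `M·B` of coefficient-list matrices of size `n`. [folklore] -/
def prodEntry (n : ℕ) (Mtab : List (List (List ℤ))) (Bcls : List (List ℤ)) (Bidx : List (List ℕ))
    (p q : ℕ) : List ℤ :=
  lsum ((List.range n).map fun r => lmul (getPoly Mtab p r) (getB Bcls Bidx r q))

/-- Every edge has two distinct endpoints below `n`. [folklore] -/
def edgesOK (n : ℕ) (E : List (ℕ × ℕ)) : Bool :=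
  E.all fun e => decide (e.1 < n) && decide (e.2 < n) && !(e.1 == e.2)

/-- The certificate checker: edges well-formed; the claimed table `Mtab` is the Edwards–Sokal matrix;
`Mtab · B = d · 1`; `d` has nonnegative coefficients and positive constant term; off-diagonal entries of
`B` have nonpositive coefficients. [folklore] -/
def check (n : ℕ) (E : List (ℕ × ℕ)) (Mtab : List (List (List ℤ))) (Bcls : List (List ℤ))
    (Bidx : List (List ℕ)) (d : List ℤ) : Bool :=
  edgesOK n E &&
  ((List.range n).all fun p => (List.range n).all fun q => lEq (getPoly Mtab p q) (entry n E p q)) &&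
  ((List.range n).all fun p => (List.range n).all fun q =>
      lEq (prodEntry n Mtab Bcls Bidx p q) (if p = q then d else [])) &&
  (lNonneg d && lPosHead d) &&
  ((List.range n).all fun p => (List.range n).all fun q => (p == q) || lNonpos (getB Bcls Bidx p q))

/-! ### Spin configurations coded by naturals (used by the soundness proof) -/

/-- `ℤˣ ≃ Fin 2`: `1 ↦ 1`, `-1 ↦ 0`. [folklore] -/
def unitsEquivFin2 : ℤˣ ≃ Fin 2 where
  toFun u := if u = 1 then 1 else 0
  invFun j := if j = 1 then 1 else -1
  left_inv u := by rcases Int.units_eq_one_or u with rfl | rfl <;> decide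
  right_inv j := by revert j; decide

/-- Spin configurations on `Fin n` ≃ `Fin (2^n)` (site `p` is `+1` iff bit `p` is set). [folklore] -/
def cfgEquiv (n : ℕ) : SpinConfig (Fin n) ≃ Fin (2 ^ n) :=
  ((Equiv.refl (Fin n)).arrowCongr unitsEquivFin2).trans finFunctionFinEquiv

/-- Spin at a natural-number site (junk value `1` out of range). [folklore] -/
def spinN {n : ℕ} (ω : SpinConfig (Fin n)) (a : ℕ) : ℤ :=
  if h : a < n then ((ω ⟨a, h⟩ : ℤˣ) : ℤ) else 1

/-- Number of satisfied edges of a genuine configuration. [folklore] -/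
def satCountR {n : ℕ} (ω : SpinConfig (Fin n)) : List (ℕ × ℕ) → ℕ
  | [] => 0
  | e :: es => if spinN ω e.1 = spinN ω e.2 then satCountR ω es + 1 else satCountR ω es

/-! ### The pair interaction attached to an edge list -/

/-- The pair `{a, b} ⊆ Fin n` attached to the `i`-th edge `(a, b)` of `E` (as a filter, so that no
bound proofs are needed; it has two elements when `edgesOK n E`). [folklore] -/
def edgeSet (n : ℕ) (E : List (ℕ × ℕ)) (i : Fin E.length) : Finset (Fin n) :=
  Finset.univ.filter fun z => z.val = (E[i.1]).1 ∨ z.val = (E[i.1]).2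

end IsingPolynomial

end Literature.Probability.LatticeModels
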